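import Summits.CriticalPhenomena.PercolationContinuityZ3.Theorems.TallClusterMassBound.Negative.TopShellOverlapFloor
import Summits.CriticalPhenomena.PercolationContinuityZ3.Theorems.TallClusterMassBound.Negative.FalseWithoutCriticality

/-!
# `TallClusterMassBound` (stmt-CriticalPhenomena-0912), line `replica-overlap-cs-transfer` — the exchange rate, landed

The line skeleton `Cruxes/TallClusterMassBound/Lines/replica-overlap-cs-transfer.lean` reduces the crux

  `TallClusterMassBound` (`= MassBoundAt p_c (11/4)`, `Negative.tallClusterMassBound_iff`):
  `M(R) := Σ_{x ∈ B_R} P_{p_c}(0 ↔_ℍ x, arm_ℍ(0,R)) ≤ C R^{11/4} π_s(R)`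

to two registered stubs by a SORRY-FREE composition (dyadic shells, shell-wise Cauchy–Schwarz, geometric
series). Three line leads found no engine for either stub; this file makes the composition itself — the only
closed mathematics of the line — an importable theorem of the tree, with the stubs as EXPLICIT HYPOTHESES
(no new definitions), so that the reduction survives the line:

* `tallClusterMassBound_of_topShellOverlap_of_wallArmLowerRegularity` :
  (top-shell replica overlap `Σ_{B_n ∖ B_{n/2}} P(0 ↔_ℍ x, arm_n)² ≤ C_F n^{5/2} π_s(n)²`, all `n ≥ 1`)
  → (wall-arm lower regularity `π_s(n) ≤ C_W (r/n)^λ π_s(r)`, `1 ≤ n ≤ r`, some `λ < 11/4`)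
  → `TallClusterMassBound`.
* `tallClusterMassBound_of_topShellOverlap_of_dyadicSum` : the same with the regularity replaced by the
  weakest AVERAGED cross-scale input the bookkeeping consumes,
  `Σ_{i<R} (R/2^i)^{11/4} π_s(R/2^i) ≤ C_D R^{11/4} π_s(R)`.
* (companion file `…ReplicaOverlapGlueTwoScale.lean`) `tallClusterMassBound_of_twoScaleShellOverlap` : the
  regularity-free two-scale variant (T) `Σ_{B_n ∖ B_{n/2}} P(0 ↔_ℍ x, arm_R)² ≤ C n^{5/2} π_s(R)²`
  (`1 ≤ n ≤ R`) ALONE → `TallClusterMassBound`.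
* `tallClusterMassBound_of_condOverlap` : the global conditional replica overlap (CSB)
  `Σ_{B_n} P(0 ↔_ℍ x, arm_n)² ≤ C n^{5/2} π_s(n)²` ALONE → `TallClusterMassBound` (one Cauchy–Schwarz).

Status of the hypotheses (NOT claimed here): all four are open at `p_c(ℤ³)`; the top-shell / CSB / (T) overlap
bounds are heuristically `x_h ≥ 1/4` (bulk density decay, the conjunct-strength content of B, Disproof §8.4(b)),
false at `p = 1` (`Negative.real_conn_inter_arm_one`) like the crux itself; the regularity hypothesis is
equivalent to a uniform `2^k`-fold wall-arm extension bound (`ReplicaOverlap.wallArmLowerRegularity_iff_pow_extension`).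
Proofs adapted verbatim from the registered skeleton (crux-plan gens 1–2); vocabulary `Pp`, `conn`, `arm`,
`armProb`, `mass`, `MassBoundAt` from `Negative.MassExponentFamily`.
-/

noncomputable section

open MeasureTheory Finset Filter
open Literature.Probability.Percolation Literature.Probability.LatticeModels
open Summit.CriticalPhenomena.PercolationContinuityZ3.Theses.PercLowPointHalfSpace (TallClusterMassBound)
open Summit.CriticalPhenomena.PercolationContinuityZ3.Theorems.TallClusterMassBound.Negative

namespace Summit.CriticalPhenomena.PercolationContinuityZ3.Theorems.TallClusterMassBound.ReplicaOverlap

/-! ## Elementary bookkeeping -/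

/-- Taller is rarer: `arm R ⊆ arm n` for `n ≤ R`. [folklore] -/
theorem arm_subset_arm_of_le {n R : ℕ} (h : n ≤ R) : arm R ⊆ arm n := by
  rintro ω ⟨y, ⟨i, hi⟩, hy⟩
  exact ⟨y, ⟨i, le_trans (by exact_mod_cast h) hi⟩, hy⟩

/-- `P(0 ↔_ℍ x, arm_R) ≤ P(0 ↔_ℍ x, arm_n)` for `n ≤ R`. [folklore] -/
theorem real_conn_inter_arm_anti (p : unitInterval) (x : V3) {n R : ℕ} (h : n ≤ R) :
    (Pp p).real (conn x ∩ arm R) ≤ (Pp p).real (conn x ∩ arm n) :=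
  measureReal_mono (Set.inter_subset_inter_right _ (arm_subset_arm_of_le h))

/-- The root term of the mass: `P(0 ↔_ℍ 0, arm_R) = π_s(R)`. [folklore] -/
theorem real_conn_zero_inter_arm_eq (p : unitInterval) (R : ℕ) :
    (Pp p).real (conn 0 ∩ arm R) = armProb p R := by
  rw [conn_zero, Set.univ_inter]; rfl

/-- `box 3 0 = {0}`. [folklore] -/
theorem box_three_zero_eq : box 3 0 = {0} := by
  ext x
  simp only [mem_box, Nat.cast_zero, neg_zero, Finset.mem_singleton]
  constructor
  · intro h
    funext i
    exact le_antisymm (h i).2 (h i).1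
  · rintro rfl i
    simp

/-- Iterated halving: `R / 2^i / 2 = R / 2^(i+1)`. [folklore] -/
theorem div_two_pow_div_two (R i : ℕ) : R / 2 ^ i / 2 = R / 2 ^ (i + 1) := by
  rw [Nat.div_div_eq_div_mul, pow_succ]

/-- DYADIC PARTITION of a box sum: peel the top shells `B_{R/2^i} ∖ B_{R/2^{i+1}}`, `i < N`. [folklore] -/
theorem sum_box_eq_sum_box_add_sum_shells (g : V3 → ℝ) (R : ℕ) : ∀ N : ℕ,
    ∑ x ∈ box 3 R, g x = ∑ x ∈ box 3 (R / 2 ^ N), g x +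
      ∑ i ∈ Finset.range N, ∑ x ∈ annulus 3 (R / 2 ^ (i + 1)) (R / 2 ^ i), g x
  | 0 => by simp
  | N + 1 => by
    rw [Finset.sum_range_succ, sum_box_eq_sum_box_add_sum_shells g R N]
    have hsub : box 3 (R / 2 ^ (N + 1)) ⊆ box 3 (R / 2 ^ N) := by
      refine box_mono 3 ?_
      rw [← div_two_pow_div_two]
      exact Nat.div_le_self _ _
    have hsplit := Finset.sum_sdiff hsub (f := g)
    rw [annulus]
    linarith

/-- The dyadic partition down to the root: `Σ_{B_R} g = g 0 + Σ_{i<R} Σ_{B_{R/2^i} ∖ B_{R/2^{i+1}}} g`.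
[folklore] -/
theorem sum_box_eq_root_add_sum_shells (g : V3 → ℝ) (R : ℕ) :
    ∑ x ∈ box 3 R, g x = g 0 +
      ∑ i ∈ Finset.range R, ∑ x ∈ annulus 3 (R / 2 ^ (i + 1)) (R / 2 ^ i), g x := by
  have h := sum_box_eq_sum_box_add_sum_shells g R R
  have h0 : R / 2 ^ R = 0 := Nat.div_eq_of_lt (Nat.lt_two_pow_self)
  rw [h0, box_three_zero_eq, Finset.sum_singleton] at h
  exact h

/-- SHELL-WISE CAUCHY–SCHWARZ (ℓ² → ℓ¹ on one shell): an overlap bound `Σ_{s} f² ≤ C n^{5/2} P²` on a set of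
at most `27 n³` points gives the mass bound `Σ_{s} f ≤ √(27 C⁺) n^{11/4} P`. [folklore] -/
theorem sum_le_of_sum_sq_le {C : ℝ} {n : ℕ} (hn : 1 ≤ n) {s : Finset V3}
    (hs : (#s : ℝ) ≤ 27 * (n : ℝ) ^ 3) {f : V3 → ℝ} (hf : ∀ x, 0 ≤ f x) {P : ℝ} (hP : 0 ≤ P)
    (h : ∑ x ∈ s, (f x) ^ 2 ≤ C * (n : ℝ) ^ ((5 : ℝ) / 2) * P ^ 2) :
    ∑ x ∈ s, f x ≤ Real.sqrt (27 * max C 0) * (n : ℝ) ^ ((11 : ℝ) / 4) * P := by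
  have hr0 : (0 : ℝ) < n := by exact_mod_cast hn
  set A : ℝ := ∑ x ∈ s, f x with hA
  have hA0 : 0 ≤ A := Finset.sum_nonneg fun x _ => hf x
  have hCS : A ^ 2 ≤ (∑ x ∈ s, (f x) ^ 2) * (#s : ℝ) := by
    have h := Finset.sum_mul_sq_le_sq_mul_sq s (fun x => f x) (fun _ => (1 : ℝ))
    simpa [hA] using h
  have hmax : 0 ≤ max C 0 := le_max_right _ _
  have hsum : ∑ x ∈ s, (f x) ^ 2 ≤ max C 0 * (n : ℝ) ^ ((5 : ℝ) / 2) * P ^ 2 := by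
    refine le_trans h ?_
    have : C ≤ max C 0 := le_max_left _ _
    have hnn : 0 ≤ (n : ℝ) ^ ((5 : ℝ) / 2) * P ^ 2 := by positivity
    nlinarith [mul_le_mul_of_nonneg_right this hnn]
  have h3 : (n : ℝ) ^ (3 : ℝ) = (n : ℝ) ^ 3 := by
    rw [show (3 : ℝ) = ((3 : ℕ) : ℝ) by norm_num, Real.rpow_natCast]
  have hpow : ((n : ℝ) ^ ((11 : ℝ) / 4)) ^ 2 = (n : ℝ) ^ ((5 : ℝ) / 2) * (n : ℝ) ^ 3 := by
    rw [← h3, ← Real.rpow_add hr0, ← Real.rpow_natCast, ← Real.rpow_mul hr0.le]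
    congr 1
    push_cast
    norm_num
  have hsq : (Real.sqrt (27 * max C 0)) ^ 2 = 27 * max C 0 := Real.sq_sqrt (by positivity)
  have hB : A ^ 2 ≤ (Real.sqrt (27 * max C 0) * (n : ℝ) ^ ((11 : ℝ) / 4) * P) ^ 2 := by
    calc A ^ 2 ≤ (∑ x ∈ s, (f x) ^ 2) * (#s : ℝ) := hCS
      _ ≤ (max C 0 * (n : ℝ) ^ ((5 : ℝ) / 2) * P ^ 2) * (27 * (n : ℝ) ^ 3) :=
          mul_le_mul hsum hs (by positivity) (mul_nonneg (mul_nonneg hmax (by positivity)) (sq_nonneg _))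
      _ = (Real.sqrt (27 * max C 0) * (n : ℝ) ^ ((11 : ℝ) / 4) * P) ^ 2 := by
          rw [mul_pow, mul_pow, hsq, hpow]; ring
  have hBnonneg : 0 ≤ Real.sqrt (27 * max C 0) * (n : ℝ) ^ ((11 : ℝ) / 4) * P := by positivity
  exact (pow_le_pow_iff_left₀ hA0 hBnonneg (by norm_num : (2 : ℕ) ≠ 0)).1 hB

/-- Exponent bookkeeping: `n^{11/4} (R/n)^λ = (n/R)^{11/4-λ} R^{11/4}` for `0 < n`, `0 < R`. [folklore] -/
theorem rpow_mul_div_rpow_eq {n R lam : ℝ} (hn : 0 < n) (hR : 0 < R) :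
    n ^ ((11 : ℝ) / 4) * (R / n) ^ lam = (n / R) ^ ((11 : ℝ) / 4 - lam) * R ^ ((11 : ℝ) / 4) := by
  have h1 : (0 : ℝ) < n ^ lam := Real.rpow_pos_of_pos hn lam
  have h2 : (0 : ℝ) < R ^ lam := Real.rpow_pos_of_pos hR lam
  have h3 : (0 : ℝ) < R ^ ((11 : ℝ) / 4) := Real.rpow_pos_of_pos hR _
  have h4 : (0 : ℝ) < n ^ ((11 : ℝ) / 4) := Real.rpow_pos_of_pos hn _
  rw [Real.div_rpow hR.le hn.le, Real.div_rpow hn.le hR.le, Real.rpow_sub hn, Real.rpow_sub hR]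
  field_simp

/-- Dyadic decay of the scale factor: for the `i`-th shell radius `n = R / 2^i`,
`(n/R)^δ ≤ ((2^δ)⁻¹)^i` (`δ ≥ 0`, `R ≥ 1`). [folklore] -/
theorem div_pow_rpow_le_inv_pow {R i : ℕ} {δ : ℝ} (hδ : 0 ≤ δ) (hR : 1 ≤ R) :
    (((R / 2 ^ i : ℕ) : ℝ) / R) ^ δ ≤ (((2 : ℝ) ^ δ)⁻¹) ^ i := by
  have hR0 : (0 : ℝ) < R := by exact_mod_cast hR
  have hle : (((R / 2 ^ i : ℕ) : ℝ) / R) ≤ ((2 : ℝ) ^ i)⁻¹ := by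
    have h1 : ((R / 2 ^ i : ℕ) : ℝ) ≤ (R : ℝ) / (2 : ℝ) ^ i := by
      have := Nat.cast_div_le (α := ℝ) (m := R) (n := 2 ^ i)
      push_cast at this
      exact this
    rw [div_le_iff₀ hR0]
    calc ((R / 2 ^ i : ℕ) : ℝ) ≤ (R : ℝ) / (2 : ℝ) ^ i := h1
      _ = ((2 : ℝ) ^ i)⁻¹ * R := by ring
  have hnn : 0 ≤ (((R / 2 ^ i : ℕ) : ℝ) / R) := by positivity
  calc (((R / 2 ^ i : ℕ) : ℝ) / R) ^ δ ≤ (((2 : ℝ) ^ i)⁻¹) ^ δ := Real.rpow_le_rpow hnn hle hδ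
    _ = (((2 : ℝ) ^ i) ^ δ)⁻¹ := Real.inv_rpow (by positivity) δ
    _ = (((2 : ℝ) ^ δ) ^ i)⁻¹ := by
        congr 1
        rw [← Real.rpow_natCast (2 : ℝ) i, ← Real.rpow_mul (by norm_num), mul_comm,
          Real.rpow_mul (by norm_num), Real.rpow_natCast]
    _ = (((2 : ℝ) ^ δ)⁻¹) ^ i := by rw [inv_pow]

/-- The mass splits as root term plus dyadic shells:
`M_p(R) = π_p(R) + Σ_{i<R} Σ_{B_{R/2^i} ∖ B_{R/2^{i+1}}} P_p(0 ↔_ℍ x, arm_R)`. [folklore] -/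
theorem mass_eq_armProb_add_sum_shells (p : unitInterval) (R : ℕ) :
    mass p R = armProb p R +
      ∑ i ∈ Finset.range R, ∑ x ∈ annulus 3 (R / 2 ^ (i + 1)) (R / 2 ^ i), (Pp p).real (conn x ∩ arm R) := by
  have hmass := sum_box_eq_root_add_sum_shells (fun x => (Pp p).real (conn x ∩ arm R)) R
  rw [real_conn_zero_inter_arm_eq] at hmass
  exact hmass

/-- Summing a geometric bound over the shells: if shell `i` is at most `A q^i X` (`0 ≤ q < 1`, `A, X ≥ 0`)
then `M_p(R) ≤ (1 + A (1-q)⁻¹) R^{11/4} π_p(R)` provided `X = R^{11/4} π_p(R)` and `R ≥ 1`. [folklore] -/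
theorem mass_le_of_shell_le_geometric (p : unitInterval) {R : ℕ} (hR : 1 ≤ R) {A q : ℝ} (hA : 0 ≤ A)
    (hq0 : 0 ≤ q) (hq1 : q < 1)
    (shell : ∀ i : ℕ, ∑ x ∈ annulus 3 (R / 2 ^ (i + 1)) (R / 2 ^ i), (Pp p).real (conn x ∩ arm R)
      ≤ A * q ^ i * ((R : ℝ) ^ ((11 : ℝ) / 4) * armProb p R)) :
    mass p R ≤ (1 + A * (1 - q)⁻¹) * (R : ℝ) ^ ((11 : ℝ) / 4) * armProb p R := by
  have hπR := armProb_nonneg p R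
  have geom : ∑ i ∈ Finset.range R, q ^ i ≤ (1 - q)⁻¹ := by
    have hs : Summable fun i : ℕ => q ^ i := summable_geometric_of_lt_one hq0 hq1
    calc ∑ i ∈ Finset.range R, q ^ i ≤ ∑' i : ℕ, q ^ i :=
          hs.sum_le_tsum (Finset.range R) fun i _ => pow_nonneg hq0 i
      _ = (1 - q)⁻¹ := tsum_geometric_of_lt_one hq0 hq1
  have hRpow1 : (1 : ℝ) ≤ (R : ℝ) ^ ((11 : ℝ) / 4) := Real.one_le_rpow (by exact_mod_cast hR) (by norm_num)
  have hX0 : 0 ≤ (R : ℝ) ^ ((11 : ℝ) / 4) * armProb p R := by positivity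
  calc mass p R
      = armProb p R + ∑ i ∈ Finset.range R,
          ∑ x ∈ annulus 3 (R / 2 ^ (i + 1)) (R / 2 ^ i), (Pp p).real (conn x ∩ arm R) :=
        mass_eq_armProb_add_sum_shells p R
    _ ≤ armProb p R + ∑ i ∈ Finset.range R, A * q ^ i * ((R : ℝ) ^ ((11 : ℝ) / 4) * armProb p R) :=
        add_le_add le_rfl (Finset.sum_le_sum fun i _ => shell i)
    _ = armProb p R + A * (∑ i ∈ Finset.range R, q ^ i) * ((R : ℝ) ^ ((11 : ℝ) / 4) * armProb p R) := by
        rw [Finset.mul_sum, Finset.sum_mul]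
    _ ≤ (R : ℝ) ^ ((11 : ℝ) / 4) * armProb p R
          + A * (1 - q)⁻¹ * ((R : ℝ) ^ ((11 : ℝ) / 4) * armProb p R) := by
        refine add_le_add ?_ ?_
        · simpa using mul_le_mul_of_nonneg_right hRpow1 hπR
        · exact mul_le_mul_of_nonneg_right (mul_le_mul_of_nonneg_left geom hA) hX0
    _ = (1 + A * (1 - q)⁻¹) * (R : ℝ) ^ ((11 : ℝ) / 4) * armProb p R := by ring

/-! ## The cross-scale input: regularity ⟹ the averaged dyadic bound -/

/-- The regularity stub implies the averaged dyadic hypothesis of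
`tallClusterMassBound_of_topShellOverlap_of_dyadicSum` (geometric series): the two doors are nested.
[folklore] -/
theorem dyadicSum_of_wallArmLowerRegularity
    (hReg : ∃ C lam : ℝ, lam < (11 : ℝ) / 4 ∧ ∀ n r : ℕ, 1 ≤ n → n ≤ r →
      armProb (criticalProbI 3) n ≤ C * ((r : ℝ) / n) ^ lam * armProb (criticalProbI 3) r) :
    ∃ C : ℝ, ∀ R : ℕ, 1 ≤ R →
      ∑ i ∈ Finset.range R, ((R / 2 ^ i : ℕ) : ℝ) ^ ((11 : ℝ) / 4) * armProb (criticalProbI 3) (R / 2 ^ i)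
        ≤ C * (R : ℝ) ^ ((11 : ℝ) / 4) * armProb (criticalProbI 3) R := by
  obtain ⟨CW, lam, hlam, hW⟩ := hReg
  set p : unitInterval := criticalProbI 3 with hp
  set δ : ℝ := (11 : ℝ) / 4 - lam with hδdef
  have hδ : 0 < δ := by rw [hδdef]; linarith
  set q : ℝ := ((2 : ℝ) ^ δ)⁻¹ with hq
  have hq1 : q < 1 := inv_lt_one_of_one_lt₀ (Real.one_lt_rpow (by norm_num) hδ)
  have hq0 : 0 ≤ q := by positivity
  set CW' : ℝ := max CW 0 with hCW'
  have hCW'0 : 0 ≤ CW' := le_max_right _ _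
  refine ⟨CW' * (1 - q)⁻¹, fun R hR => ?_⟩
  have hR0 : (0 : ℝ) < R := by exact_mod_cast hR
  have hπR := armProb_nonneg p R
  have term : ∀ i : ℕ, ((R / 2 ^ i : ℕ) : ℝ) ^ ((11 : ℝ) / 4) * armProb p (R / 2 ^ i)
      ≤ CW' * q ^ i * ((R : ℝ) ^ ((11 : ℝ) / 4) * armProb p R) := by
    intro i
    set n : ℕ := R / 2 ^ i with hn
    rcases Nat.eq_zero_or_pos n with hn0 | hnpos
    · rw [hn0]
      have : ((0 : ℕ) : ℝ) ^ ((11 : ℝ) / 4) = 0 := by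
        rw [Nat.cast_zero, Real.zero_rpow (by norm_num)]
      rw [this, zero_mul]
      positivity
    · have hn1 : 1 ≤ n := hnpos
      have hnR : n ≤ R := Nat.div_le_self _ _
      have hn0r : (0 : ℝ) < n := by exact_mod_cast hn1
      have hw := hW n R hn1 hnR
      have hfac0 : 0 ≤ ((R : ℝ) / n) ^ lam := by positivity
      have hw' : armProb p n ≤ CW' * ((R : ℝ) / n) ^ lam * armProb p R :=
        hw.trans (mul_le_mul_of_nonneg_right (mul_le_mul_of_nonneg_right (le_max_left _ _) hfac0) hπR)
      have hid := rpow_mul_div_rpow_eq (lam := lam) hn0r hR0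
      have hsf : ((n : ℝ) / R) ^ δ ≤ q ^ i := by
        have := div_pow_rpow_le_inv_pow (i := i) hδ.le hR
        rwa [← hn] at this
      calc (n : ℝ) ^ ((11 : ℝ) / 4) * armProb p n
          ≤ (n : ℝ) ^ ((11 : ℝ) / 4) * (CW' * ((R : ℝ) / n) ^ lam * armProb p R) :=
            mul_le_mul_of_nonneg_left hw' (by positivity)
        _ = CW' * ((n : ℝ) ^ ((11 : ℝ) / 4) * ((R : ℝ) / n) ^ lam) * armProb p R := by ring
        _ = CW' * (((n : ℝ) / R) ^ δ * (R : ℝ) ^ ((11 : ℝ) / 4)) * armProb p R := by rw [hid]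
        _ ≤ CW' * (q ^ i * (R : ℝ) ^ ((11 : ℝ) / 4)) * armProb p R := by
            have hRp : 0 ≤ (R : ℝ) ^ ((11 : ℝ) / 4) := by positivity
            exact mul_le_mul_of_nonneg_right
              (mul_le_mul_of_nonneg_left (mul_le_mul_of_nonneg_right hsf hRp) hCW'0) hπR
        _ = CW' * q ^ i * ((R : ℝ) ^ ((11 : ℝ) / 4) * armProb p R) := by ring
  have geom : ∑ i ∈ Finset.range R, q ^ i ≤ (1 - q)⁻¹ := by
    have hs : Summable fun i : ℕ => q ^ i := summable_geometric_of_lt_one hq0 hq1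
    calc ∑ i ∈ Finset.range R, q ^ i ≤ ∑' i : ℕ, q ^ i :=
          hs.sum_le_tsum (Finset.range R) fun i _ => pow_nonneg hq0 i
      _ = (1 - q)⁻¹ := tsum_geometric_of_lt_one hq0 hq1
  have hX0 : 0 ≤ (R : ℝ) ^ ((11 : ℝ) / 4) * armProb p R := by positivity
  calc ∑ i ∈ Finset.range R, ((R / 2 ^ i : ℕ) : ℝ) ^ ((11 : ℝ) / 4) * armProb p (R / 2 ^ i)
      ≤ ∑ i ∈ Finset.range R, CW' * q ^ i * ((R : ℝ) ^ ((11 : ℝ) / 4) * armProb p R) :=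
        Finset.sum_le_sum fun i _ => term i
    _ = CW' * (∑ i ∈ Finset.range R, q ^ i) * ((R : ℝ) ^ ((11 : ℝ) / 4) * armProb p R) := by
        rw [Finset.mul_sum, Finset.sum_mul]
    _ ≤ CW' * (1 - q)⁻¹ * ((R : ℝ) ^ ((11 : ℝ) / 4) * armProb p R) :=
        mul_le_mul_of_nonneg_right (mul_le_mul_of_nonneg_left geom hCW'0) hX0
    _ = CW' * (1 - q)⁻¹ * (R : ℝ) ^ ((11 : ℝ) / 4) * armProb p R := by ring

/-! ## Three conditional forms of the crux (the fourth, (T), is in the companion file) -/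

/-- **THE WEAKEST CROSS-SCALE INPUT THE BOOKKEEPING CONSUMES.** At `p_c(ℤ³)`: the top-shell overlap bound
(stub 1) together with the AVERAGED dyadic bound `Σ_{i<R} (R/2^i)^{11/4} π_s(R/2^i) ≤ C_D R^{11/4} π_s(R)`
(implied by the regularity stub via a geometric series, but weaker) implies `TallClusterMassBound`.
(Adapted from the skeleton's `massBoundAt_of_topShell_of_dyadicSum`.) [folklore] -/
theorem tallClusterMassBound_of_topShellOverlap_of_dyadicSum
    (hTop : ∃ C : ℝ, ∀ n : ℕ, 1 ≤ n →
      ∑ x ∈ annulus 3 (n / 2) n, ((Pp (criticalProbI 3)).real (conn x ∩ arm n)) ^ 2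
        ≤ C * (n : ℝ) ^ ((5 : ℝ) / 2) * (armProb (criticalProbI 3) n) ^ 2)
    (hDyadic : ∃ C : ℝ, ∀ R : ℕ, 1 ≤ R →
      ∑ i ∈ Finset.range R, ((R / 2 ^ i : ℕ) : ℝ) ^ ((11 : ℝ) / 4) * armProb (criticalProbI 3) (R / 2 ^ i)
        ≤ C * (R : ℝ) ^ ((11 : ℝ) / 4) * armProb (criticalProbI 3) R) :
    TallClusterMassBound := by
  obtain ⟨CF, hF⟩ := hTop
  obtain ⟨CD, hD⟩ := hDyadic
  refine tallClusterMassBound_iff.2 ?_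
  set p : unitInterval := criticalProbI 3 with hp
  set K : ℝ := Real.sqrt (27 * max CF 0) with hK
  have hK0 : 0 ≤ K := Real.sqrt_nonneg _
  refine ⟨1 + K * max CD 0, fun R hR => ?_⟩
  have hR0 : (0 : ℝ) < R := by exact_mod_cast hR
  have hπR := armProb_nonneg p R
  -- shell i is bounded by K n_i^{11/4} π(n_i), n_i = R / 2^i (and by 0 if n_i = 0)
  have shell : ∀ i : ℕ, ∑ x ∈ annulus 3 (R / 2 ^ (i + 1)) (R / 2 ^ i), (Pp p).real (conn x ∩ arm R)
      ≤ K * (((R / 2 ^ i : ℕ) : ℝ) ^ ((11 : ℝ) / 4) * armProb p (R / 2 ^ i)) := by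
    intro i
    set n : ℕ := R / 2 ^ i with hn
    rcases Nat.eq_zero_or_pos n with hn0 | hnpos
    · have hn1 : R / 2 ^ (i + 1) = 0 := by rw [← div_two_pow_div_two, ← hn, hn0]
      rw [hn1, hn0]
      simp only [annulus, sdiff_self, Finset.bot_eq_empty, Finset.sum_empty]
      exact mul_nonneg hK0 (mul_nonneg (by positivity) (armProb_nonneg p 0))
    · have hn1 : 1 ≤ n := hnpos
      have hnR : n ≤ R := Nat.div_le_self _ _
      have hπn := armProb_nonneg p n
      have step1 : ∑ x ∈ annulus 3 (R / 2 ^ (i + 1)) (R / 2 ^ i), (Pp p).real (conn x ∩ arm R)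
          ≤ ∑ x ∈ annulus 3 (n / 2) n, (Pp p).real (conn x ∩ arm n) := by
        rw [← div_two_pow_div_two, ← hn]
        exact Finset.sum_le_sum fun x _ => real_conn_inter_arm_anti p x hnR
      have step2 : ∑ x ∈ annulus 3 (n / 2) n, (Pp p).real (conn x ∩ arm n)
          ≤ K * (n : ℝ) ^ ((11 : ℝ) / 4) * armProb p n :=
        sum_le_of_sum_sq_le hn1 (card_annulus_le_cube hn1 _) (fun _ => measureReal_nonneg) hπn (hF n hn1)
      calc _ ≤ K * (n : ℝ) ^ ((11 : ℝ) / 4) * armProb p n := step1.trans step2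
        _ = K * ((n : ℝ) ^ ((11 : ℝ) / 4) * armProb p n) := by ring
  have hRpow1 : (1 : ℝ) ≤ (R : ℝ) ^ ((11 : ℝ) / 4) := Real.one_le_rpow (by exact_mod_cast hR) (by norm_num)
  have hX0 : 0 ≤ (R : ℝ) ^ ((11 : ℝ) / 4) * armProb p R := by positivity
  have hDR := hD R hR
  have hD' : ∑ i ∈ Finset.range R, ((R / 2 ^ i : ℕ) : ℝ) ^ ((11 : ℝ) / 4) * armProb p (R / 2 ^ i)
      ≤ max CD 0 * ((R : ℝ) ^ ((11 : ℝ) / 4) * armProb p R) := by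
    refine hDR.trans ?_
    calc CD * (R : ℝ) ^ ((11 : ℝ) / 4) * armProb p R = CD * ((R : ℝ) ^ ((11 : ℝ) / 4) * armProb p R) := by ring
      _ ≤ max CD 0 * ((R : ℝ) ^ ((11 : ℝ) / 4) * armProb p R) := mul_le_mul_of_nonneg_right (le_max_left _ _) hX0
  calc mass p R
      = armProb p R + ∑ i ∈ Finset.range R,
          ∑ x ∈ annulus 3 (R / 2 ^ (i + 1)) (R / 2 ^ i), (Pp p).real (conn x ∩ arm R) :=
        mass_eq_armProb_add_sum_shells p R
    _ ≤ armProb p R + ∑ i ∈ Finset.range R,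
          K * (((R / 2 ^ i : ℕ) : ℝ) ^ ((11 : ℝ) / 4) * armProb p (R / 2 ^ i)) :=
        add_le_add le_rfl (Finset.sum_le_sum fun i _ => shell i)
    _ = armProb p R + K * ∑ i ∈ Finset.range R,
          ((R / 2 ^ i : ℕ) : ℝ) ^ ((11 : ℝ) / 4) * armProb p (R / 2 ^ i) := by rw [Finset.mul_sum]
    _ ≤ (R : ℝ) ^ ((11 : ℝ) / 4) * armProb p R + K * (max CD 0 * ((R : ℝ) ^ ((11 : ℝ) / 4) * armProb p R)) := by
        refine add_le_add ?_ (mul_le_mul_of_nonneg_left hD' hK0)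
        simpa using mul_le_mul_of_nonneg_right hRpow1 hπR
    _ = (1 + K * max CD 0) * (R : ℝ) ^ ((11 : ℝ) / 4) * armProb p R := by ring

/-- **THE LINE'S EXCHANGE RATE.** At `p_c(ℤ³)`: a top-shell replica-overlap bound
`Σ_{x ∈ B_n ∖ B_{⌊n/2⌋}} P(0 ↔_ℍ x, arm_n)² ≤ C_F n^{5/2} π_s(n)²` for all `n ≥ 1` (registered stub
`stub_topShellOverlap`) together with a two-scale LOWER regularity of the wall one-arm
`π_s(n) ≤ C_W (r/n)^λ π_s(r)` for `1 ≤ n ≤ r` with some `λ < 11/4` (registered stub `stub_wallArmLowerRegularity`)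
implies the crux `TallClusterMassBound`. Proof: `M(R) = π(R) + Σ_i Σ_{shell i}`; on the shell of radius
`n = R/2^i`, `arm_R ⊆ arm_n`, Cauchy–Schwarz gives `≤ √(27 C_F) n^{11/4} π_s(n)`, regularity gives
`n^{11/4} π_s(n) ≤ C_W (n/R)^{11/4-λ} R^{11/4} π_s(R) ≤ C_W 2^{-iδ} R^{11/4} π_s(R)`; geometric series — here
factored as `dyadicSum_of_wallArmLowerRegularity` followed by
`tallClusterMassBound_of_topShellOverlap_of_dyadicSum`. (The registered skeleton's
`massBoundAt_of_topShell_of_regularity` / `TallClusterMassBound_of`, with the stubs as hypotheses.) [folklore] -/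
theorem tallClusterMassBound_of_topShellOverlap_of_wallArmLowerRegularity :
    (∃ C : ℝ, ∀ n : ℕ, 1 ≤ n →
      ∑ x ∈ annulus 3 (n / 2) n, ((Pp (criticalProbI 3)).real (conn x ∩ arm n)) ^ 2
        ≤ C * (n : ℝ) ^ ((5 : ℝ) / 2) * (armProb (criticalProbI 3) n) ^ 2) →
    (∃ C lam : ℝ, lam < (11 : ℝ) / 4 ∧ ∀ n r : ℕ, 1 ≤ n → n ≤ r →
      armProb (criticalProbI 3) n ≤ C * ((r : ℝ) / n) ^ lam * armProb (criticalProbI 3) r) →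
    TallClusterMassBound :=
  fun hTop hReg =>
    tallClusterMassBound_of_topShellOverlap_of_dyadicSum hTop (dyadicSum_of_wallArmLowerRegularity hReg)

/-- **THE GLOBAL CONDITIONAL REPLICA OVERLAP (CSB) ALONE IMPLIES THE CRUX**, by ONE Cauchy–Schwarz over the
box: at `p_c(ℤ³)`, `Σ_{x ∈ B_n} P(0 ↔_ℍ x, arm_n)² ≤ C n^{5/2} π_s(n)²` for all `n ≥ 1` gives
`M(n) ≤ √(27C) n^{11/4} π_s(n)`. (The idea card's transfer in conditional form; triage r1-2 `csb_implies_crux`;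
skeleton `massBoundAt_of_condOverlap`.) CSB implies the top-shell hypothesis of
`tallClusterMassBound_of_topShellOverlap_of_wallArmLowerRegularity` (the shell is part of the box) but needs
no regularity. [folklore] -/
theorem tallClusterMassBound_of_condOverlap
    (hCSB : ∃ C : ℝ, ∀ n : ℕ, 1 ≤ n →
      ∑ x ∈ box 3 n, ((Pp (criticalProbI 3)).real (conn x ∩ arm n)) ^ 2
        ≤ C * (n : ℝ) ^ ((5 : ℝ) / 2) * (armProb (criticalProbI 3) n) ^ 2) :
    TallClusterMassBound := by
  obtain ⟨C, hC⟩ := hCSB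
  refine tallClusterMassBound_iff.2 ⟨Real.sqrt (27 * max C 0), fun n hn => ?_⟩
  have hcard : (#(box 3 n) : ℝ) ≤ 27 * (n : ℝ) ^ 3 := by
    rw [card_box]
    push_cast
    have h1' : (1 : ℝ) ≤ n := by exact_mod_cast hn
    have hr0 : (0 : ℝ) < n := by linarith
    nlinarith [h1', sq_nonneg ((n : ℝ) - 1), mul_pos hr0 hr0]
  exact sum_le_of_sum_sq_le hn hcard (fun _ => measureReal_nonneg) (armProb_nonneg _ _) (hC n hn)

end Summit.CriticalPhenomena.PercolationContinuityZ3.Theorems.TallClusterMassBound.ReplicaOverlap
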